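import Literature.AlgebraicGeometry.ShimuraVarieties.UnitaryCurveSiegelChartMover          -- ★ FILE D (A-p01): `exists_sliceChart_mover` (the slice chart at `b a`), `SiegelShimuraSet`, `ShimuraSetGS`, `conjJ`, `C0`
import Literature.AlgebraicGeometry.ShimuraVarieties.UnitaryCurveHeckeOrbitExtContinuous       -- ★ p850424 (LA4-p03 (g2), (β1)): `ShimuraSetGS.continuous_of_forall_continuous_mk` (K open: piecewise ⇒ continuous) and its density consequences
import Literature.AlgebraicGeometry.Motives.BaseChangePointsProofs                           -- ★ `AlgPoints.continuous_baseChangeEquiv[_symm]` (the `ℚ`-points currency)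
import HarnessLib

/-!
# A map on the complex points of the unitary Shimura CURVE whose SIEGEL SHADOW is `[J v, x(a)]` is CONTINUOUS

Topic `AlgebraicGeometry/ShimuraVarieties`; namespace `…ShimuraVarieties.UnitaryCurve` (the chart currency of ★ FILE D `UnitaryCurveSiegelChartMover`).  THEOREMS ONLY (no
definition, no named fact, no instance, no notation, no `sorry`).  Cell `hodgecm-mathlib` (D-0151), P6 «MOD programme» (crux hLiu418 =
stmt-HodgeConjecture-24832, `--supports`, count-neutral), line «L4», closer `stub_SHEET` road B′ (LA4-plan (g2) 2026-09-02 07:43:53Z ∕ 08:01:03Z,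
E-pen A-p01 (g28) 08:01:35Z «=»): DEAL #35 «`f₂` CONTINUOUS» (LA4-p01 (g3)).  The twisted-side point map of road B′,
`f₂ [v, aK] := pts⁻¹ [J v, b(a)·ũ_V(1, z)]` (the classifying point of the Serre-tensored marked fibre), must be CONTINUOUS on `Sh_K(ℂ)` so that the
Hecke-orbit density argument ([Milne2005ShimuraVarieties] Lemma 13.5 ∕ Thm. 13.6, ★ `ShimuraSetGS.eq_of_forall_mk_eq`; LA4-p03 (g2) (β1)) carries the CM point
law of the conjugate slice (★ `UnitaryCurveConjugateSliceDescends`, reciprocity at CM points) to every point.  This file proves the continuity for ANY map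
`F : Sh_K(ℂ) → M(ℂ)` whose Siegel shadow `pts (F [v, aK]) = [J v, x(a)]` is given by an ARBITRARY assignment `x : G(𝔸_f) → GSp_δ(𝔸_f)` (no regularity in
`a` is needed: `K` is open, so the adelic coordinate is discrete in the quotient), in the abstract chart currency of ★ FILE D ∕ ★ E4
`UnitaryCurveSiegelBorel` (pieces `Sc`, inclusions `ιc`, uniformisations `unif` continuous on `𝔥_g`, principal representatives `rep`, the Siegel bijection
`pts`, the period chart law `hZ` of the Hodge datum `J`) — the case `x := b` is the chart map `f` of the E-line itself (whose continuity was so far derived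
only inside ★ E4՚s Borel argument), the case `x a := b(a)·ũ_V(1,z)` is `f₂`.

THE MATHEMATICS ([Milne2005ShimuraVarieties] Lemma 5.13 p. 57 (the pieces `Γ_a \ X⁺` of `Sh_K(ℂ)`), Thm. 6.11 p. 74 and (63) p. 116 (the Siegel double coset and
its principal representatives); [Deligne1979ShimuraVarieties] 2.1.2 and Prop. 2.3.10 (the period point is holomorphic, in particular continuous, in the Hodge
structure); [Deligne1971TravauxShimura] 4.11–4.12).  Fix `a`.  By strong approximation for `GSp_δ` read through the principal representatives (the cover
`hrep`: every class of `GSp_δ(ℚ)\[S^± × GSp_δ(𝔸_f)/K_δ(N)]` is `[J(W), rep c]`), the class `[J v₀, x(a)]` of one cone point is `[J(W₀), rep c]`, i.e.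
`γ⁻¹ J(v₀) γ = J(W₀)` and `γ · rep c ≡ x(a)` for a rational `γ`; `γ⁻¹` has negative multiplier, so `v ↦ γ⁻¹ J(v) γ` maps the WHOLE cone into `S⁺` and the
period chart law gives an entrywise-holomorphic `Z : cone → 𝔥_g` with `γ⁻¹ J(v) γ = J(Z v)`, whence `[J v, x(a)] = [J(Z v), rep c]` for all `v` (§2, ★ FILE D
§1 with `b a` replaced by `x(a)` — its proof never used more).  Then `F [v, aK] = pts⁻¹ [J(Z v), rep c] = ιc_c (unif_c (Z v))` (`pts_unif`, `pts` injective) is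
the composite of the continuous maps `Z` (holomorphic entries), `unif_c` (continuous on `𝔥_g`) and `ιc_c` on points (★ `AlgPoints.continuous_map`) — §3.  Finally
a map on the quotient `Sh_K(ℂ) = G(ℚ)\[𝔻 × G(𝔸_f)/K]` is continuous as soon as every piece map `v ↦ F [v, aK]` is (`K` open, `G(𝔸_f)/K` discrete — ★ p850424
`ShimuraSetGS.continuous_of_forall_continuous_mk`, LA4-p03 (g2)).

* (§1 — «`K` open, every piece map continuous ⇒ `F` continuous» — is ★ p850424 `ShimuraSetGS.continuous_of_forall_continuous_mk` (LA4-p03 (g2), (β1)), imported;)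
* §2 `UnitaryCurve.exists_sliceChart_mover_of_mem` — ★ FILE D `exists_sliceChart_mover` for an ARBITRARY `y : GSp_δ(𝔸_f)` in place of `b a`;
* §3 `UnitaryCurve.continuous_mk_left_of_pts_shadow` (per `a` — the SHAPE ★ p850424 `eq_of_forall_mk_eq_of_forall_continuous_mk` consumes),
  **`UnitaryCurve.continuous_of_pts_shadow`** (THE HEAD), and the `ℚ`-points currency
  `UnitaryCurve.continuous_of_bce_pts_shadow` (`F : Sh_K(ℂ) → M(ℂ)` for a `ℚ`-scheme `M`, shadow through `bce := AlgPoints.baseChangeEquiv (ℚ → ℂ) M`, the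
  currency of the E-line՚s `f_pts`; ★ `AlgPoints.continuous_baseChangeEquiv_symm`).
HC_CM is proved only modulo the 2 remaining named inputs (hLiu418 24832, h413 24833) until rung 0 closes; nothing here is about HC.

## References
* [Milne2005ShimuraVarieties] J. S. Milne, *Introduction to Shimura varieties* (2005), Lemma 5.13 p. 57, Thm. 6.11 p. 74, (63) p. 116, Lemma 13.5 and Thm. 13.6 (proof) p. 118.
* [Deligne1979ShimuraVarieties] P. Deligne, *Variétés de Shimura* (1979), 2.1.2 and Prop. 2.3.10.
* [Deligne1971TravauxShimura] P. Deligne, *Travaux de Shimura* (1971), 4.11–4.12 pp. 148–149, Prop. 5.2 p. 155.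
* [ConradAdelicPoints2012] B. Conrad, *Weil and Grothendieck approaches to adelic points*, Enseign. Math. 58 (2012), Prop. 2.1 and Prop. 3.1.
-/

set_option autoImplicit false

noncomputable section

open Function Matrix NumberField IsDedekindDomain CategoryTheory CategoryTheory.Limits AlgebraicGeometry Topology
open scoped Matrix ComplexOrder
open Literature.AlgebraicGeometry.Motives (SchemeOver ComplexPoints AlgPoints specOver)
open Literature.NumberTheory.Automorphic (siegelUpperHalfSpace)
open Literature.NumberTheory.Automorphic.UnitaryGroup
open Literature.AlgebraicGeometry.ModuliOfAbelianVarieties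
open Literature.AlgebraicGeometry.ModuliOfAbelianVarieties.SiegelModuli (C0 mem_C0_iff jOfSiegel jOfSiegel_mem_C0)

namespace Literature.AlgebraicGeometry.ShimuraVarieties


/-! ### §2 The slice chart with its mover at an ARBITRARY finite-adelic Siegel point `y` (★ FILE D §1 with `b a ↦ y`) -/

open UnitaryCanonicalModel

namespace UnitaryCurve

variable {L : Type} [Field L] [NumberField L] [IsCMField L] {Jstar : Matrix (Fin 2) (Fin 2) L} {τ : L →+* ℂ}
variable {g : ℕ} {δ : Fin g → ℕ} {N : ℕ}
variable (J : (Fin 2 → ℂ) → Matrix (Fin g ⊕ Fin g) (Fin g ⊕ Fin g) ℝ)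
  (hJ : ∀ v : Fin 2 → ℂ, v ∈ negCone (Jstar.map τ) → J v ∈ C0pm δ)

omit [NumberField L] [IsCMField L] in
/-- **THE SLICE CHART WITH ITS MOVER AT AN ARBITRARY `y ∈ GSp_δ(𝔸_f)`** — ★ FILE D `exists_sliceChart_mover` with the adelic Siegel point `b a` replaced
by ANY `y` (its proof used `b a` only as an element): a piece `c`, an entrywise-holomorphic `𝔥_g`-valued period function `Z` on the negative cone and a
rational mover `q ∈ GSp_δ(ℚ)` with `[J v, y] = [jOfSiegel (Z v), rep c]`, (Q1) `conjJ (q_ℝ)⁻¹ (J v) = jOfSiegel δ (Z v)` and (Q2) `q_f • (rep c) K_δ(N) = y K_δ(N)`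
for every `v` on the cone.  USE: `y := b(a)·ũ_V(1,z)`, the twisted Siegel point of road B′. [cite: Milne2005ShimuraVarieties, Thm. 5.16 with Def. 5.15; Lemma 5.13 p. 57; Thm. 6.11 p. 74]
[cite: Deligne1979ShimuraVarieties, Prop. 2.3.10] -/
theorem exists_sliceChart_mover_of_mem (hg : 0 < g) (hδ : ∀ i, 0 < δ i)
    (hJneg : ∀ v : Fin 2 → ℂ, v ∈ negCone (Jstar.map τ) → -J v ∈ C0 δ)
    (hZ : ∀ γ : GL (Fin g ⊕ Fin g) ℝ, γ ∈ gspReal δ → (∀ v : Fin 2 → ℂ, v ∈ negCone (Jstar.map τ) → conjJ γ (J v) ∈ C0 δ) →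
      ∃ Z : (Fin 2 → ℂ) → Matrix (Fin g) (Fin g) ℂ,
        (∀ i j : Fin g, DifferentiableOn ℂ (fun v => Z v i j) (negCone (Jstar.map τ))) ∧
          ∀ v : Fin 2 → ℂ, v ∈ negCone (Jstar.map τ) → Z v ∈ siegelUpperHalfSpace g ∧ conjJ γ (J v) = jOfSiegel δ (Z v))
    {ι : Type*} (rep : ι → ↥(gspFinAdelic δ)) (c₀ : ι)
    (hrep : ∀ x : SiegelShimuraSet δ (principalLevelSubgroup δ N), ∃ (c : ι) (W : Matrix (Fin g) (Fin g) ℂ) (hW : W ∈ siegelUpperHalfSpace g),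
      x = SiegelShimuraSet.mk δ (principalLevelSubgroup δ N) ⟨jOfSiegel δ W, C0_subset_C0pm δ (jOfSiegel_mem_C0 hδ hW)⟩ (rep c))
    (y : ↥(gspFinAdelic δ)) :
    ∃ (c : ι) (Z : (Fin 2 → ℂ) → Matrix (Fin g) (Fin g) ℂ) (q : ↥(gspRational δ)),
      (∀ i j : Fin g, DifferentiableOn ℂ (fun v => Z v i j) (negCone (Jstar.map τ))) ∧
        ∀ (v : Fin 2 → ℂ) (hv : v ∈ negCone (Jstar.map τ)), ∃ hZv : Z v ∈ siegelUpperHalfSpace g,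
          SiegelShimuraSet.mk δ (principalLevelSubgroup δ N) ⟨J v, hJ v hv⟩ y =
              SiegelShimuraSet.mk δ (principalLevelSubgroup δ N) ⟨jOfSiegel δ (Z v), C0_subset_C0pm δ (jOfSiegel_mem_C0 hδ hZv)⟩ (rep c) ∧
            conjJ (((gspRationalToReal δ q)⁻¹ : ↥(gspReal δ)) : GL (Fin g ⊕ Fin g) ℝ) (J v) = jOfSiegel δ (Z v) ∧
            gspRationalToFinAdelic δ q • ((rep c : gspFinAdelic δ) : gspFinAdelic δ ⧸ principalLevelSubgroup δ N) =
              ((y : gspFinAdelic δ) : gspFinAdelic δ ⧸ principalLevelSubgroup δ N) := by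
  by_cases hne : (negCone (Jstar.map τ)).Nonempty
  swap
  · -- empty cone: nothing to chart
    refine ⟨c₀, fun _ => 0, 1, fun i j => ?_, fun v hv => absurd ⟨v, hv⟩ hne⟩
    exact differentiableOn_const (c := (0 : ℂ))
  obtain ⟨v₀, hv₀⟩ := hne
  -- (1) the piece and the rational translate at the base point `v₀`
  obtain ⟨c, W₀, hW₀, hq⟩ := hrep (SiegelShimuraSet.mk δ (principalLevelSubgroup δ N) ⟨J v₀, hJ v₀ hv₀⟩ y)
  obtain ⟨γ, hγJ, hγb⟩ := (SiegelShimuraSet.mk_eq_mk_iff δ (principalLevelSubgroup δ N) _ _ _ _).1 hq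
  -- `γ⁻¹ J(v₀) γ = J(W₀) ∈ X⁺`
  set M : ↥(gspReal δ) := (gspRationalToReal δ γ)⁻¹ with hM
  have hMJ₀ : conjJ (M : GL (Fin g ⊕ Fin g) ℝ) (J v₀) = jOfSiegel δ W₀ := by
    have h := congrArg (fun J' : C0pm δ => (J' : Matrix (Fin g ⊕ Fin g) (Fin g ⊕ Fin g) ℝ)) hγJ
    simp only [coe_conjAct] at h
    rw [hM, Subgroup.coe_inv, ← h, ← conjJ_mul, inv_mul_cancel, conjJ_one]
  -- (2) `γ⁻¹` has negative multiplier, hence moves the whole cone family into `X⁺`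
  have hMC0 : ∀ v : Fin 2 → ℂ, v ∈ negCone (Jstar.map τ) → conjJ (M : GL (Fin g ⊕ Fin g) ℝ) (J v) ∈ C0 δ := by
    obtain ⟨ν, hν⟩ := exists_isMultiplier_realTypeForm M.2
    rcases lt_or_gt_of_ne (Units.ne_zero ν) with hneg | hpos
    · intro v hv
      have h := neg_conjJ_mem_C0_of_neg hν hneg (hJneg v hv)
      rwa [conjJ_neg, neg_neg] at h
    · exfalso
      have h := conjJ_mem_C0_of_pos hν hpos (hJneg v₀ hv₀)
      rw [conjJ_neg, hMJ₀] at h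
      exact neg_not_mem_C0_of_mem_C0 hg (jOfSiegel_mem_C0 hδ hW₀) h
  -- (3) the chart for `γ⁻¹`
  obtain ⟨Z, hZd, hZv⟩ := hZ (M : GL (Fin g ⊕ Fin g) ℝ) M.2 hMC0
  refine ⟨c, Z, γ, hZd, fun v hv => ⟨(hZv v hv).1, ?_, ?_, hγb⟩⟩
  · -- (4) the point identity `[J v, y] = [J(Z v), rep c]`
    refine (SiegelShimuraSet.mk_eq_mk_iff δ (principalLevelSubgroup δ N) _ _ _ _).2 ⟨γ, Subtype.ext ?_, hγb⟩
    rw [coe_conjAct]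
    change conjJ _ (jOfSiegel δ (Z v)) = J v
    rw [← (hZv v hv).2, hM, Subgroup.coe_inv, ← conjJ_mul, mul_inv_cancel, conjJ_one]
  · -- (Q1) the mover defines `Z`
    rw [← hM]
    exact (hZv v hv).2

/-! ### §3 THE HEAD: a map with Siegel shadow `[J v, x(a)]` is continuous -/

section Shadow

variable (hg : 0 < g) (hδ : ∀ i, 0 < δ i)
  (hJneg : ∀ v : Fin 2 → ℂ, v ∈ negCone (Jstar.map τ) → -J v ∈ C0 δ)
  (hZ : ∀ γ : GL (Fin g ⊕ Fin g) ℝ, γ ∈ gspReal δ → (∀ v : Fin 2 → ℂ, v ∈ negCone (Jstar.map τ) → conjJ γ (J v) ∈ C0 δ) →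
    ∃ Z : (Fin 2 → ℂ) → Matrix (Fin g) (Fin g) ℂ,
      (∀ i j : Fin g, DifferentiableOn ℂ (fun v => Z v i j) (negCone (Jstar.map τ))) ∧
        ∀ v : Fin 2 → ℂ, v ∈ negCone (Jstar.map τ) → Z v ∈ siegelUpperHalfSpace g ∧ conjJ γ (J v) = jOfSiegel δ (Z v))
  {κ : Type*} (Sc : κ → SchemeOver ℂ)
  (unif : ∀ _c : κ, Matrix (Fin g) (Fin g) ℂ → ComplexPoints (Sc _c))
  (unif_cont : ∀ c, ContinuousOn (unif c) (siegelUpperHalfSpace g))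
  (rep : κ → ↥(gspFinAdelic δ))
  (hrep : ∀ x : SiegelShimuraSet δ (principalLevelSubgroup δ N), ∃ (c : κ) (W : Matrix (Fin g) (Fin g) ℂ) (hW : W ∈ siegelUpperHalfSpace g),
    x = SiegelShimuraSet.mk δ (principalLevelSubgroup δ N) ⟨jOfSiegel δ W, C0_subset_C0pm δ (jOfSiegel_mem_C0 hδ hW)⟩ (rep c))
  (K : Subgroup ↥(finAdelic (↥(maximalRealSubfield L)) L (IsCMField.complexConj L) 2 Jstar))
  (x : ↥(finAdelic (↥(maximalRealSubfield L)) L (IsCMField.complexConj L) 2 Jstar) → ↥(gspFinAdelic δ))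

include hg hJneg hZ unif_cont hrep in
/-- **PIECE BY PIECE: a map with Siegel shadow `[J v, x(a)]` is continuous in `v` on each piece.**  For ANY assignment `x : G(𝔸_f) → GSp_δ(𝔸_f)` and any
`F : Sh_K(ℂ) → M(ℂ)` with `pts (F [v, aK]) = [J v, x(a)]`: the slice chart at `y := x(a)` (§2) gives `F [v, aK] = ιc_c (unif_c (Z v))` on the cone (`pts`
injective, `pts_unif`), a composite of `Z` (holomorphic entries ⇒ continuous), `unif_c` (continuous on `𝔥_g`) and `ιc_c` on points (★ `AlgPoints.continuous_map`).
[cite: Deligne1979ShimuraVarieties, 2.1.2 and Prop. 2.3.10] [cite: Milne2005ShimuraVarieties, Lemma 5.13 p. 57, Thm. 6.11 p. 74] -/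
theorem continuous_mk_left_of_pts_shadow {Mc : SchemeOver ℂ} (ιc : ∀ c, Sc c ⟶ Mc)
    (pts : ComplexPoints Mc ≃ SiegelShimuraSet δ (principalLevelSubgroup δ N))
    (pts_unif : ∀ (c : κ) (W : Matrix (Fin g) (Fin g) ℂ) (hW : W ∈ siegelUpperHalfSpace g),
      pts (AlgPoints.map (ιc c) (unif c W)) =
        SiegelShimuraSet.mk δ (principalLevelSubgroup δ N) ⟨jOfSiegel δ W, C0_subset_C0pm δ (jOfSiegel_mem_C0 hδ hW)⟩ (rep c))
    (F : ShimuraSetGS L Jstar τ K → ComplexPoints Mc)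
    (hF : ∀ (v : Fin 2 → ℂ) (hv : v ∈ negCone (Jstar.map τ)) (a : ↥(finAdelic (↥(maximalRealSubfield L)) L (IsCMField.complexConj L) 2 Jstar)),
      pts (F (ShimuraSetGS.mk L Jstar τ K v hv a)) = SiegelShimuraSet.mk δ (principalLevelSubgroup δ N) ⟨J v, hJ v hv⟩ (x a))
    (a : ↥(finAdelic (↥(maximalRealSubfield L)) L (IsCMField.complexConj L) 2 Jstar)) :
    Continuous fun w : ↥(negCone (Jstar.map τ)) => F (ShimuraSetGS.mk L Jstar τ K (w : Fin 2 → ℂ) w.2 a) := by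
  classical
  by_cases hne : (negCone (Jstar.map τ)).Nonempty
  swap
  · -- empty cone: the piece is empty
    haveI : IsEmpty ↥(negCone (Jstar.map τ)) := ⟨fun w => hne ⟨(w : Fin 2 → ℂ), w.2⟩⟩
    exact continuous_of_const fun w => isEmptyElim w
  obtain ⟨v₀, hv₀⟩ := hne
  -- a default piece (for §2's vacuous branch) and the slice chart at `y := x a`
  obtain ⟨c₀, -⟩ := hrep (SiegelShimuraSet.mk δ (principalLevelSubgroup δ N) ⟨J v₀, hJ v₀ hv₀⟩ (x a))
  obtain ⟨c, Z, _q, hZd, hZpt⟩ := exists_sliceChart_mover_of_mem J hJ hg hδ hJneg hZ rep c₀ hrep (x a)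
  -- the piece map IS `ιc_c ∘ unif_c ∘ Z` on the cone (`pts` injective, `pts_unif`)
  have hfun : (fun w : ↥(negCone (Jstar.map τ)) => F (ShimuraSetGS.mk L Jstar τ K (w : Fin 2 → ℂ) w.2 a)) =
      fun w : ↥(negCone (Jstar.map τ)) => AlgPoints.map (ιc c) (unif c (Z (w : Fin 2 → ℂ))) := by
    funext w
    obtain ⟨hZw, hmk, -, -⟩ := hZpt (w : Fin 2 → ℂ) w.2
    apply pts.injective
    rw [hF, hmk, pts_unif c (Z (w : Fin 2 → ℂ)) hZw]
  rw [hfun]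
  -- `Z` is continuous on the cone (holomorphic entries), `unif_c` on `𝔥_g`, `ιc_c` on points
  have hZc : ContinuousOn Z (negCone (Jstar.map τ)) :=
    continuousOn_pi.2 fun i => continuousOn_pi.2 fun j => (hZd i j).continuousOn
  have hZc' : Continuous fun w : ↥(negCone (Jstar.map τ)) => Z (w : Fin 2 → ℂ) :=
    hZc.comp_continuous continuous_subtype_val fun w => w.2
  have hU : Continuous fun w : ↥(negCone (Jstar.map τ)) => unif c (Z (w : Fin 2 → ℂ)) :=
    (unif_cont c).comp_continuous hZc' fun w => (hZpt (w : Fin 2 → ℂ) w.2).1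
  exact (AlgPoints.continuous_map (ιc c)).comp hU

include hg hJneg hZ unif_cont hrep in
/-- **THE HEAD — A MAP ON `Sh_K(ℂ)` WITH SIEGEL SHADOW `[J v, x(a)]` IS CONTINUOUS** (`K` open).  For ANY assignment `x : G(𝔸_f) → GSp_δ(𝔸_f)` and any
`F : Sh_K(ℂ) → M(ℂ)` with `pts (F [v, aK]) = [J v, x(a)]` on all representatives, `F` is continuous: piece by piece (`continuous_mk_left_of_pts_shadow`) and
★ p850424 `ShimuraSetGS.continuous_of_forall_continuous_mk`.  USE (road B′ of hodgecm՚s `stub_SHEET`): `x := b` gives the continuity of the E-line՚s chart map `f`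
(shadow `f_pts`), `x a := b(a)·ũ_V(1,z)` that of the twisted-side map `f₂ [v,aK] := pts⁻¹[J v, b(a)·ũ_V(1,z)]` (DEAL #35), the input of the Hecke-orbit density
step ★ `ShimuraSetGS.eq_of_forall_mk_eq`. [cite: Milne2005ShimuraVarieties, Lemma 5.13 p. 57, Thm. 6.11 p. 74, Lemma 13.5 and Thm. 13.6 (proof) p. 118]
[cite: Deligne1979ShimuraVarieties, 2.1.2 and Prop. 2.3.10] -/
theorem continuous_of_pts_shadow {Mc : SchemeOver ℂ} (ιc : ∀ c, Sc c ⟶ Mc)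
    (pts : ComplexPoints Mc ≃ SiegelShimuraSet δ (principalLevelSubgroup δ N))
    (pts_unif : ∀ (c : κ) (W : Matrix (Fin g) (Fin g) ℂ) (hW : W ∈ siegelUpperHalfSpace g),
      pts (AlgPoints.map (ιc c) (unif c W)) =
        SiegelShimuraSet.mk δ (principalLevelSubgroup δ N) ⟨jOfSiegel δ W, C0_subset_C0pm δ (jOfSiegel_mem_C0 hδ hW)⟩ (rep c))
    (hK : IsOpen (K : Set ↥(finAdelic (↥(maximalRealSubfield L)) L (IsCMField.complexConj L) 2 Jstar)))
    (F : ShimuraSetGS L Jstar τ K → ComplexPoints Mc)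
    (hF : ∀ (v : Fin 2 → ℂ) (hv : v ∈ negCone (Jstar.map τ)) (a : ↥(finAdelic (↥(maximalRealSubfield L)) L (IsCMField.complexConj L) 2 Jstar)),
      pts (F (ShimuraSetGS.mk L Jstar τ K v hv a)) = SiegelShimuraSet.mk δ (principalLevelSubgroup δ N) ⟨J v, hJ v hv⟩ (x a)) :
    Continuous F :=
  ShimuraSetGS.continuous_of_forall_continuous_mk K hK
    (continuous_mk_left_of_pts_shadow J hJ hg hδ hJneg hZ Sc unif unif_cont rep hrep K x ιc pts pts_unif F hF)

include hg hJneg hZ unif_cont hrep in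
/-- **The same in the `ℚ`-POINTS CURRENCY of the E-line** (`M` a `ℚ`-scheme, pieces of `M ⊗_ℚ ℂ`, `F : Sh_K(ℂ) → M(ℂ)`, shadow read through
`AlgPoints.baseChangeEquiv (ℚ → ℂ) M` exactly as in the chart՚s `f_pts`): `F` is continuous — the head for `baseChangeEquiv ∘ F`, then ★
`AlgPoints.continuous_baseChangeEquiv_symm`. [cite: Milne2005ShimuraVarieties, Lemma 5.13 p. 57, Thm. 6.11 p. 74] [cite: ConradAdelicPoints2012, Prop. 2.1 and Prop. 3.1] -/
theorem continuous_of_bce_pts_shadow {M : SchemeOver ℚ} (ιc : ∀ c, Sc c ⟶ (Motives.baseChange ℚ ℂ).obj M)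
    (pts : ComplexPoints ((Motives.baseChange ℚ ℂ).obj M) ≃ SiegelShimuraSet δ (principalLevelSubgroup δ N))
    (pts_unif : ∀ (c : κ) (W : Matrix (Fin g) (Fin g) ℂ) (hW : W ∈ siegelUpperHalfSpace g),
      pts (AlgPoints.map (ιc c) (unif c W)) =
        SiegelShimuraSet.mk δ (principalLevelSubgroup δ N) ⟨jOfSiegel δ W, C0_subset_C0pm δ (jOfSiegel_mem_C0 hδ hW)⟩ (rep c))
    (hK : IsOpen (K : Set ↥(finAdelic (↥(maximalRealSubfield L)) L (IsCMField.complexConj L) 2 Jstar)))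
    (F : ShimuraSetGS L Jstar τ K → ComplexPoints M)
    (hF : ∀ (v : Fin 2 → ℂ) (hv : v ∈ negCone (Jstar.map τ)) (a : ↥(finAdelic (↥(maximalRealSubfield L)) L (IsCMField.complexConj L) 2 Jstar)),
      pts (AlgPoints.baseChangeEquiv (algebraMap ℚ ℂ) M (F (ShimuraSetGS.mk L Jstar τ K v hv a))) =
        SiegelShimuraSet.mk δ (principalLevelSubgroup δ N) ⟨J v, hJ v hv⟩ (x a)) :
    Continuous F := by
  have h1 : Continuous fun P => AlgPoints.baseChangeEquiv (algebraMap ℚ ℂ) M (F P) :=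
    continuous_of_pts_shadow J hJ hg hδ hJneg hZ Sc unif unif_cont rep hrep K x ιc pts pts_unif hK
      (fun P => AlgPoints.baseChangeEquiv (algebraMap ℚ ℂ) M (F P)) hF
  have h2 := (Motives.AlgPoints.continuous_baseChangeEquiv_symm (algebraMap ℚ ℂ) M).comp h1
  refine (continuous_congr fun P => ?_).1 h2
  exact (AlgPoints.baseChangeEquiv (algebraMap ℚ ℂ) M).symm_apply_apply (F P)

end Shadow

end UnitaryCurve

end Literature.AlgebraicGeometry.ShimuraVarieties

end
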